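/-
Copyright (c) 2026 the pub-hodgecm-mathlib formalisation cell (harness21).  Prover seat hodgecm-mathlib-LH4-p06 (g5), Track A «(D-RAM) FOUR-FRAME», unit U2H, census leaf
(ρ2b′-X) `stub_U2H_fixedPointCensus_typeTwo_unit0` — SOCKET (C) `orderCountCensusC` (type RamM), hand (C-2) «DEP∕TOP dischargers of ★ p857711's `hvTop`» (LH4-p04 (g5)
SOCKET (C) LEAD LINE #1, dealer LH4-plan (g12) WORD #30), FILE (L-prep): ELEMENTARY RADII AND THE ★ LAW REPACKAGED.  2026-09-04.
-/
import Summits.HodgeConjecture.HodgeConjecture.Theorems.F0P3cDyRamToricLevelCensusRamMTopLawWindow   -- ★ p857910 (this seat); brings ★ Pack p857870∕880∕886, ★ Side p857841, ★ LAW-i p857816, ★ TopPrep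
import HarnessLib

/-!
# T5c (C-2, L-prep): radii of the unit twists and the ★ RamM law repackaged for the top-cell law (`…RamMTopCellsLaw`)

Cell `hodgecm-mathlib` (D-0151), FLOOR 0, crux H413 = `stmt-HodgeConjecture-24833`; squad F0∕P3c∕LH4; lane `--supports stmt-HodgeConjecture-24833 --as helper` (count-neutral).
THEOREMS ONLY (no `def`, no instance, no notation, no `sorry`, default heartbeats).  Socket served: LH4-p04 (g5)'s SOCKET (C) `orderCountCensusC` (type RamM bottom of
(ρ2b′-X)), brick (C-2) «DEP∕TOP»: the letter `hvTop` of ★ p857711 `toricCensusSum_ramM` says that on the coincidence diagonal `j + m = jλ + a` a non-generic cell is alive on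
the `+` side iff `2j + (g + s0) ≤ 2jλ + 1 ∧ (j + a + 2 ≤ m + s0 + 2g ∨ ε = 1)` (and `ε = −1` on the `−` side).  In the radius letter `c := j + a − m` (`= 2j − jλ` on the
diagonal; cell radius `exp(−(2c + d_ρ))`) the sequel `…RamMTopCellsLaw` proves exactly that law for the two classes of ★ p857841, and THIS FILE prepares it:
`TP(c) :⟺ ∃ ω ∈ U_M, |κ·t(ω) − 1| ≤ exp(−(2c + d_ρ))`, `TE(c) :⟺ ∃ ω ∈ U_M, |κ·ψ(n₀)·t(ω) − 1| ≤ exp(−(2c + d_ρ))` (`κ = ρμ∕μ`, `μ = λ − u`, `t(ω) = ρN(ω)∕N(ω)`, `ψ(n₀) = ρn₀∕n₀`):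
* §1 elementary radii: `|ψ(y) − 1| ≤ exp(−2d′)` for every `Θ`-fixed unit `y` (third-field different bound); inside `κ`'s ball `|κy − 1| ≤ r ⟺ |y − 1| ≤ r`;
  both classes alive at `ω = 1` down to `κ`'s own radius while above `2d′`; both DEAD beyond `κ`'s radius when `|κ − 1| > exp(−2d′)` (`jλ < m + s0`);
* §2 the ★ law repackaged: alive (T or E) ⇒ depth for `s0 ≤ c` with NO token bound (★ LAW-i `→`); depth ⇒ alive in some class under `m + s0 ≤ jλ` (★ LAW-i `←` +
  ★ dichotomy); class E inside `κ`'s ball is the threshold `k + 2 ≤ dΘ` (★ `anchored_twist_near_iff_lt_threshold`).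
HONEST LABEL.  Count-neutral (`--supports`); unconditional local algebra; nothing of (ρ2b′-X) is asserted — `HC_CM` is proved only modulo the 7 printed citations (2 remaining named
inputs: hLiu418 = `stmt-HodgeConjecture-24832`, h413 = `stmt-HodgeConjecture-24833`) until rung 0 closes.

## References
* [Serre1979] J.-P. Serre, *Local Fields*, GTM 67 (1979): Ch. IV §1 Prop. 3–4 (the different of a ramified quadratic extension); Ch. V §1; Ch. V §3 Prop. 5, Cor. 3.
* [Kottwitz1986BaseChangeUnits] R. E. Kottwitz, *Base change for unit elements of Hecke algebras*, Compositio Math. 60 (1986): §1 pp. 240–241.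
* [Jacobowitz1962] R. Jacobowitz, *Hermitian forms over local fields*, Amer. J. Math. 84 (1962): §4.
-/

set_option autoImplicit false

noncomputable section

namespace Summit.HodgeConjecture.HodgeConjecture.Cruxes.H413.F0P3cDyRamToricLevelCensusRamM

open WithZero IsLocalRing
open scoped Valued
open Literature.NumberTheory.Automorphic.UnitaryThreeFourFrame (IsRamifiedQuadraticDatum)
open Literature.NumberTheory.LocalFields.QuadraticOrder Literature.NumberTheory.LocalFields.WildQuadraticDatum

variable {K : Type} [Field K] [Valued K ℤᵐ⁰] {ρ Θ τ : K →+* K} {α ϖE : K} {dρ t dτ tτ : ℕ}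
variable {K' : Type*} [Field K'] [Valued K' ℤᵐ⁰] {σ' : K' →+* K'} {π' : K'} {d' : ℕ}

/-! ## §1 Elementary radii: the unit twists live in `1 + 𝔭^{2d′}` -/

/-- **`|ψ(y) − 1| ≤ exp(−2d′)` FOR A `Θ`-FIXED UNIT `y`** (`y = jK x`, `|x − σ′x| ≤ |π′|^{d′}` for the integral `x` of the third field — ★ `v_sub_map_le_pow_of_v_le_one`).
[cite: Serre1979, Ch. IV §1 Prop. 3–4] -/
theorem v_twist_thetaFixed_sub_one_le (hσ' : ∀ x, σ' (σ' x) = x) (hfix' : ∀ x : K', σ' x = x → x ≠ 0 → ∃ n : ℤ, Valued.v x = exp (2 * n))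
    (hπ' : Valued.v π' = exp (-1 : ℤ)) (hdd' : Valued.v (π' - σ' π') = Valued.v π' ^ d')
    (jK : K' →+* K) (hjle : ∀ x y : K', Valued.v (jK x) ≤ Valued.v (jK y) ↔ Valued.v x ≤ Valued.v y)
    (hjfix : ∀ z : K, Θ z = z → ∃ x, jK x = z) (hjσ : ∀ x, jK (σ' x) = ρ (jK x)) (hjπ : Valued.v (jK π') = exp (-2 : ℤ))
    {y : K} (hΘy : Θ y = y) (hy1 : Valued.v y = 1) : Valued.v (ρ y / y - 1) ≤ exp (-(2 * (d' : ℤ))) := by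
  obtain ⟨x, rfl⟩ := hjfix y hΘy
  have hx1 : Valued.v x = 1 := (v_eq_one_iff_of_le_iff jK hjle x).1 hy1
  have hx0 : jK x ≠ 0 := fun h0 => by rw [h0, map_zero] at hy1; exact zero_ne_one hy1
  have h1 : ρ (jK x) / jK x - 1 = -(jK (x - σ' x) / jK x) := by rw [map_sub, hjσ]; field_simp; ring
  rw [h1, Valuation.map_neg, map_div₀, hy1, div_one, ← v_map_pow_eq_exp_neg_two_mul jK hjπ d', ← map_pow, hjle, map_pow]
  exact v_sub_map_le_pow_of_v_le_one hσ' hfix' hπ' hdd' hx1.le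

/-- `|t(ω) − 1| ≤ exp(−2d′)` for every unit `ω` (`t(ω) = ψ(N(ω))`, `N(ω) = ωΘω` is a `Θ`-fixed unit). [cite: Serre1979, Ch. IV §1 Prop. 3–4] -/
theorem v_twist_norm_sub_one_le (hΘΘ : ∀ x, Θ (Θ x) = x) (hvΘ : ∀ x, Valued.v (Θ x) = Valued.v x)
    (hσ' : ∀ x, σ' (σ' x) = x) (hfix' : ∀ x : K', σ' x = x → x ≠ 0 → ∃ n : ℤ, Valued.v x = exp (2 * n))
    (hπ' : Valued.v π' = exp (-1 : ℤ)) (hdd' : Valued.v (π' - σ' π') = Valued.v π' ^ d')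
    (jK : K' →+* K) (hjle : ∀ x y : K', Valued.v (jK x) ≤ Valued.v (jK y) ↔ Valued.v x ≤ Valued.v y)
    (hjfix : ∀ z : K, Θ z = z → ∃ x, jK x = z) (hjσ : ∀ x, jK (σ' x) = ρ (jK x)) (hjπ : Valued.v (jK π') = exp (-2 : ℤ))
    {ω : K} (hω : Valued.v ω = 1) : Valued.v (ρ (ω * Θ ω) / (ω * Θ ω) - 1) ≤ exp (-(2 * (d' : ℤ))) :=
  v_twist_thetaFixed_sub_one_le hσ' hfix' hπ' hdd' jK hjle hjfix hjσ hjπ (by rw [map_mul, hΘΘ, mul_comm]) (by rw [map_mul, hvΘ, hω, mul_one])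

/-- In the ball of `κ`: if `|κ − 1| ≤ r` (and `|κ| = 1`) then `|κ·y − 1| ≤ r ⟺ |y − 1| ≤ r`. [cite: Serre1979, Ch. V §1] -/
theorem v_mul_sub_one_le_iff_of_near_one {κ y : K} {r : ℤᵐ⁰} (hκ : Valued.v (κ - 1) ≤ r) (hκ1 : Valued.v κ = 1) :
    Valued.v (κ * y - 1) ≤ r ↔ Valued.v (y - 1) ≤ r := by
  refine ⟨fun h => ?_, fun h => by rw [mul_comm]; exact (v_div_sub_one_le_and_mul h hκ hκ1).2⟩
  have hκ0 : κ ≠ 0 := fun h0 => by rw [h0, map_zero] at hκ1; exact zero_ne_one hκ1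
  have h' := (v_div_sub_one_le_and_mul h hκ hκ1).1
  rwa [mul_div_cancel_left₀ _ hκ0] at h'

/-- Outside the ball: if `|y − 1| < |κ − 1|` then `|κ·y − 1| = |κ − 1|` (`κy − 1 = (κ − 1) + κ(y − 1)`, `|κ| = 1`). [cite: Serre1979, Ch. V §1] -/
theorem v_mul_sub_one_eq_of_lt {κ y : K} (hκ1 : Valued.v κ = 1) (hlt : Valued.v (y - 1) < Valued.v (κ - 1)) :
    Valued.v (κ * y - 1) = Valued.v (κ - 1) := by
  have h1 : κ * y - 1 = κ - 1 + κ * (y - 1) := by ring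
  have h2 : Valued.v (κ * (y - 1)) < Valued.v (κ - 1) := by rwa [map_mul, hκ1, one_mul]
  rw [h1, Valuation.map_add_eq_of_lt_left _ h2]


/-- **`TP(c)` AND `TE(c)` INSIDE THE BALL OF `κ` BELOW `2d′`** (`ω = 1`): if `exp(−(2c + d_ρ)) ≥ |κ − 1|` and `2c + d_ρ ≤ 2d′` then `|κ·ψ(n₀) − 1| ≤ exp(−(2c + d_ρ))`
for every `Θ`-fixed unit `n₀`. [cite: Serre1979, Ch. V §1] -/
theorem anchoredNear_of_le_of_le
    (hσ' : ∀ x, σ' (σ' x) = x) (hfix' : ∀ x : K', σ' x = x → x ≠ 0 → ∃ n : ℤ, Valued.v x = exp (2 * n))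
    (hπ' : Valued.v π' = exp (-1 : ℤ)) (hdd' : Valued.v (π' - σ' π') = Valued.v π' ^ d')
    (jK : K' →+* K) (hjle : ∀ x y : K', Valued.v (jK x) ≤ Valued.v (jK y) ↔ Valued.v x ≤ Valued.v y)
    (hjfix : ∀ z : K, Θ z = z → ∃ x, jK x = z) (hjσ : ∀ x, jK (σ' x) = ρ (jK x)) (hjπ : Valued.v (jK π') = exp (-2 : ℤ))
    {n₀ : K} (hΘn₀ : Θ n₀ = n₀) (hn₀1 : Valued.v n₀ = 1)
    {κ : K} (hκ1 : Valued.v κ = 1) {r : ℤᵐ⁰} (hκ : Valued.v (κ - 1) ≤ r) (hr : exp (-(2 * (d' : ℤ))) ≤ r) :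
    ∃ ω : K, Valued.v ω = 1 ∧ Valued.v (κ * (ρ n₀ / n₀) * (ρ (ω * Θ ω) / (ω * Θ ω)) - 1) ≤ r :=
  ⟨1, Valuation.map_one _, by
    rw [one_mul, map_one, map_one, div_one, mul_one, v_mul_sub_one_le_iff_of_near_one hκ hκ1]
    exact (v_twist_thetaFixed_sub_one_le hσ' hfix' hπ' hdd' jK hjle hjfix hjσ hjπ hΘn₀ hn₀1).trans hr⟩

/-- **BOTH CLASSES ARE DEAD BEYOND `κ` WHEN `κ` IS SHALLOW**: if `|κ − 1| > exp(−2d′)` (i.e. `jλ < m + s0`) then for every radius `r < |κ − 1|` neither `TP` nor `TE` holds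
at `r` — every unit twist `t(ω)`, `ψ(n₀)t(ω)` lies in `1 + 𝔭^{2d′}`, so `|κ·t(ω) − 1| = |κ − 1| > r`. [cite: Serre1979, Ch. IV §1 Prop. 3–4, Ch. V §1] -/
theorem not_twistNear_not_anchoredNear_of_shallow (hΘΘ : ∀ x, Θ (Θ x) = x) (hvΘ : ∀ x, Valued.v (Θ x) = Valued.v x)
    (hvρ : ∀ x, Valued.v (ρ x) = Valued.v x)
    (hσ' : ∀ x, σ' (σ' x) = x) (hfix' : ∀ x : K', σ' x = x → x ≠ 0 → ∃ n : ℤ, Valued.v x = exp (2 * n))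
    (hπ' : Valued.v π' = exp (-1 : ℤ)) (hdd' : Valued.v (π' - σ' π') = Valued.v π' ^ d')
    (jK : K' →+* K) (hjle : ∀ x y : K', Valued.v (jK x) ≤ Valued.v (jK y) ↔ Valued.v x ≤ Valued.v y)
    (hjfix : ∀ z : K, Θ z = z → ∃ x, jK x = z) (hjσ : ∀ x, jK (σ' x) = ρ (jK x)) (hjπ : Valued.v (jK π') = exp (-2 : ℤ))
    {n₀ : K} (hΘn₀ : Θ n₀ = n₀) (hn₀1 : Valued.v n₀ = 1)
    {κ : K} (hκ1 : Valued.v κ = 1) (hshallow : exp (-(2 * (d' : ℤ))) < Valued.v (κ - 1)) {r : ℤᵐ⁰} (hr : r < Valued.v (κ - 1)) :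
    (¬ ∃ ω : K, Valued.v ω = 1 ∧ Valued.v (κ * (ρ (ω * Θ ω) / (ω * Θ ω)) - 1) ≤ r) ∧
      ¬ ∃ ω : K, Valued.v ω = 1 ∧ Valued.v (κ * (ρ n₀ / n₀) * (ρ (ω * Θ ω) / (ω * Θ ω)) - 1) ≤ r := by
  have htw := fun {ω : K} (hω : Valued.v ω = 1) => v_twist_norm_sub_one_le hΘΘ hvΘ hσ' hfix' hπ' hdd' jK hjle hjfix hjσ hjπ (ρ := ρ) hω
  have hψ := v_twist_thetaFixed_sub_one_le hσ' hfix' hπ' hdd' jK hjle hjfix hjσ hjπ hΘn₀ hn₀1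
  have hn₀0 : n₀ ≠ 0 := fun h0 => by rw [h0, map_zero] at hn₀1; exact zero_ne_one hn₀1
  have hψ1 : Valued.v (ρ n₀ / n₀) = 1 := by rw [map_div₀, hvρ, div_self ((Valuation.ne_zero_iff _).2 hn₀0)]
  constructor
  · rintro ⟨ω, hω, hle⟩
    rw [v_mul_sub_one_eq_of_lt hκ1 ((htw hω).trans_lt hshallow)] at hle
    exact absurd (hle.trans_lt hr) (lt_irrefl _)
  · rintro ⟨ω, hω, hle⟩
    have hprod : Valued.v (ρ n₀ / n₀ * (ρ (ω * Θ ω) / (ω * Θ ω)) - 1) ≤ exp (-(2 * (d' : ℤ))) := (v_div_sub_one_le_and_mul hψ (htw hω) ?_).2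
    · rw [mul_assoc, v_mul_sub_one_eq_of_lt hκ1 (hprod.trans_lt hshallow)] at hle
      exact absurd (hle.trans_lt hr) (lt_irrefl _)
    · have hω0 : ω ≠ 0 := fun h0 => by rw [h0, map_zero] at hω; exact zero_ne_one hω
      rw [map_div₀, hvρ, div_self]
      rw [map_mul, hvΘ, hω, mul_one]; exact one_ne_zero

/-! ## §2 The ★ law repackaged: alive ⇒ depth; depth ⇒ alive in some class; the class-E threshold inside `κ`'s ball -/

/-- **ALIVE ⇒ DEPTH** (`s0 ≤ c`, NO token bound): `TP(c) ∨ TE(c)` at radius `exp(−(2c + d_ρ))` gives `2c + dτ + 2d_K ≤ 2jλ + d_ρ + 2` — a unit twist (anchored or not) near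
`κ⁻¹` is an element of `T♮` near `κ` (★ `exists_thetaFixed_normOne_near_of_twist`), and ★ LAW-i `→`. [cite: Serre1979, Ch. V §3 Prop. 5] [cite: Kottwitz1986BaseChangeUnits, §1 pp. 240–241] -/
theorem censusDepth_of_twistNear_or_anchoredNear [CompleteSpace K]
    (hD : IsRamifiedQuadraticDatum ρ α dρ t) (hΘΘ : ∀ x, Θ (Θ x) = x) (hΘρ : ∀ x, Θ (ρ x) = ρ (Θ x)) (hvΘ : ∀ x, Valued.v (Θ x) = Valued.v x)
    (hτ : ∀ x, τ x = Θ (ρ x)) (hDτ : IsRamifiedQuadraticDatum τ α dτ tτ)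
    {P : K} (hτP : τ P = P) (hP : Valued.v P = exp (-2 : ℤ)) {dK : ℕ} (hdK : Valued.v (P - ρ P) = exp (-(2 * (dK : ℤ))))
    (hfix' : ∀ x : K', σ' x = x → x ≠ 0 → ∃ n : ℤ, Valued.v x = exp (2 * n)) (hπ' : Valued.v π' = exp (-1 : ℤ))
    (jK : K' →+* K) (hjle : ∀ x y : K', Valued.v (jK x) ≤ Valued.v (jK y) ↔ Valued.v x ≤ Valued.v y)
    (hjfix : ∀ z : K, Θ z = z → ∃ x, jK x = z) (hjσ : ∀ x, jK (σ' x) = ρ (jK x)) (hjπ : Valued.v (jK π') = exp (-2 : ℤ))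
    {n₀ : K} (hΘn₀ : Θ n₀ = n₀) (hn₀1 : Valued.v n₀ = 1)
    (hϖE : Valued.v ϖE = exp (-2 : ℤ)) {lam u : K} (hlam : lam * Θ lam = 1) (hu : ρ u = u) (hu1 : u * Θ u = 1)
    {jl : ℕ} (hjl : Valued.v ((lam - u) - ρ (lam - u)) = Valued.v (ϖE ^ jl * (α - ρ α)))
    {c : ℕ} (hc : dτ ≤ 2 * c)
    (h : (∃ ω : K, Valued.v ω = 1 ∧ Valued.v (ρ (lam - u) / (lam - u) * (ρ (ω * Θ ω) / (ω * Θ ω)) - 1) ≤ exp (-(2 * (c : ℤ) + dρ))) ∨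
      ∃ ω : K, Valued.v ω = 1 ∧ Valued.v (ρ (lam - u) / (lam - u) * (ρ n₀ / n₀) * (ρ (ω * Θ ω) / (ω * Θ ω)) - 1) ≤ exp (-(2 * (c : ℤ) + dρ))) :
    2 * (c : ℤ) + dτ + 2 * dK ≤ 2 * jl + dρ + 2 := by
  obtain ⟨hρρ, hvρ, -, -, -, -, -⟩ := id hD
  have hF4 := v_eq_exp_four_mul_of_fixed_fixed hτ hfix' hπ' jK hjle hjfix hjσ hjπ
  have hlaw := exists_thetaFixed_normOne_near_iff_ramified hD hΘΘ hΘρ hvΘ hτ hDτ hτP hP hdK hF4 hϖE hlam hu hu1 hjl hc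
  have hn₀0 : n₀ ≠ 0 := fun h0 => by rw [h0, map_zero] at hn₀1; exact zero_ne_one hn₀1
  rcases h with ⟨ω, hω, hle⟩ | ⟨ω, hω, hle⟩
  · have hω0 : ω ≠ 0 := fun h0 => by rw [h0, map_zero] at hω; exact zero_ne_one hω
    exact hlaw.1 (exists_thetaFixed_normOne_near_of_twist hρρ hvρ hΘρ (by rw [map_mul, hΘΘ, mul_comm]) (mul_ne_zero hω0 ((map_ne_zero Θ).2 hω0)) hle)
  · have hω0 : ω ≠ 0 := fun h0 => by rw [h0, map_zero] at hω; exact zero_ne_one hω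
    have hre : ρ (lam - u) / (lam - u) * (ρ n₀ / n₀) * (ρ (ω * Θ ω) / (ω * Θ ω)) =
        ρ (lam - u) / (lam - u) * (ρ (n₀ * (ω * Θ ω)) / (n₀ * (ω * Θ ω))) := by rw [map_mul ρ n₀]; field_simp
    rw [hre] at hle
    exact hlaw.1 (exists_thetaFixed_normOne_near_of_twist hρρ hvρ hΘρ (by rw [map_mul, map_mul, hΘΘ, hΘn₀, mul_comm ω])
      (mul_ne_zero hn₀0 (mul_ne_zero hω0 ((map_ne_zero Θ).2 hω0))) hle)

/-- **DEPTH ⇒ ALIVE IN SOME CLASS** (`s0 ≤ c`, token bound `2d′ + 2m ≤ 2jλ + d_ρ`, i.e. `m + s0 ≤ jλ`): `2c + dτ + 2d_K ≤ 2jλ + d_ρ + 2` gives `TP(c) ∨ TE(c)` (★ LAW-i `←`,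
★ `v_sub_one_le_of_near_kappa`, ★ `twist_near_or_anchored_of_thetaFixed_near`). [cite: Serre1979, Ch. V §3 Prop. 5, Cor. 3; Ch. X §1] -/
theorem twistNear_or_anchoredNear_of_censusDepth [CompleteSpace K] [Finite 𝓀[K]]
    (hD : IsRamifiedQuadraticDatum ρ α dρ t) (hΘρ : ∀ x, Θ (ρ x) = ρ (Θ x)) (hvΘ : ∀ x, Valued.v (Θ x) = Valued.v x)
    (hτ : ∀ x, τ x = Θ (ρ x)) (hDτ : IsRamifiedQuadraticDatum τ α dτ tτ)
    {P : K} (hτP : τ P = P) (hP : Valued.v P = exp (-2 : ℤ)) {dK : ℕ} (hdK : Valued.v (P - ρ P) = exp (-(2 * (dK : ℤ))))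
    (hσ' : ∀ x, σ' (σ' x) = x) (hvσ' : ∀ x, Valued.v (σ' x) = Valued.v x) (hfix' : ∀ x : K', σ' x = x → x ≠ 0 → ∃ n : ℤ, Valued.v x = exp (2 * n))
    (hπ' : Valued.v π' = exp (-1 : ℤ)) (hdd' : Valued.v (π' - σ' π') = Valued.v π' ^ d')
    (jK : K' →+* K) (hjle : ∀ x y : K', Valued.v (jK x) ≤ Valued.v (jK y) ↔ Valued.v x ≤ Valued.v y) (hjΘ : ∀ x, Θ (jK x) = jK x)
    (hjfix : ∀ z : K, Θ z = z → ∃ x, jK x = z) (hjσ : ∀ x, jK (σ' x) = ρ (jK x)) (hjπ : Valued.v (jK π') = exp (-2 : ℤ))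
    {ϖ : K} {dΘ tΘ : ℕ} (hDΘ : IsRamifiedQuadraticDatum Θ ϖ dΘ tΘ)
    {n₀ : K} (hΘn₀ : Θ n₀ = n₀) (hn₀1 : Valued.v n₀ = 1) (hn₀N : ¬ ∃ z : K, z * Θ z = n₀)
    (hϖE : Valued.v ϖE = exp (-2 : ℤ)) {lam u : K} (hlam : lam * Θ lam = 1) (hu : ρ u = u) (hu1 : u * Θ u = 1)
    {m jl : ℕ} (hμ : Valued.v (lam - u) = Valued.v ϖE ^ m) (hjl : Valued.v ((lam - u) - ρ (lam - u)) = Valued.v (ϖE ^ jl * (α - ρ α)))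
    (hℓ : 2 * (d' : ℤ) + 2 * m ≤ 2 * jl + dρ) {c : ℕ} (hc : dτ ≤ 2 * c) (hcd : 2 * (d' : ℤ) ≤ 2 * c + dρ)
    (hdepth : 2 * (c : ℤ) + dτ + 2 * dK ≤ 2 * jl + dρ + 2) :
    (∃ ω : K, Valued.v ω = 1 ∧ Valued.v (ρ (lam - u) / (lam - u) * (ρ (ω * Θ ω) / (ω * Θ ω)) - 1) ≤ exp (-(2 * (c : ℤ) + dρ))) ∨
      ∃ ω : K, Valued.v ω = 1 ∧ Valued.v (ρ (lam - u) / (lam - u) * (ρ n₀ / n₀) * (ρ (ω * Θ ω) / (ω * Θ ω)) - 1) ≤ exp (-(2 * (c : ℤ) + dρ)) := by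
  obtain ⟨hρρ, hvρ, -, -, -, -, -⟩ := id hD
  have hΘΘ := hDΘ.1
  have hF4 := v_eq_exp_four_mul_of_fixed_fixed hτ hfix' hπ' jK hjle hjfix hjσ hjπ
  obtain ⟨x, hΘx, hx, hκx⟩ := (exists_thetaFixed_normOne_near_iff_ramified hD hΘΘ hΘρ hvΘ hτ hDτ hτP hP hdK hF4 hϖE hlam hu hu1 hjl hc).2 hdepth
  exact twist_near_or_anchored_of_thetaFixed_near hvρ hvΘ hσ' hvσ' hfix' hπ' hdd' jK hjle hjΘ hjfix hjσ hjπ hDΘ hΘn₀ hn₀1 hn₀N hΘx hx hκx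
    (v_sub_one_le_of_near_kappa hD hϖE hμ hjl hcd hℓ hκx)

/-- **CLASS E INSIDE THE BALL OF `κ` IS THE THRESHOLD**: if `|κ − 1| ≤ |jK π′^{d′+k}|` then `TE` at that radius ⟺ `k + 2 ≤ dΘ` (reduce to `κ = 1` and ★ `anchored_twist_near_iff_lt_threshold`).
[cite: Serre1979, Ch. V §3 Cor. 3] -/
theorem anchoredNear_iff_lt_threshold_of_near_one [CompleteSpace K] [Finite 𝓀[K]] (hvΘ : ∀ x, Valued.v (Θ x) = Valued.v x)
    (hσ' : ∀ x, σ' (σ' x) = x) (hvσ' : ∀ x, Valued.v (σ' x) = Valued.v x) (hfix' : ∀ x : K', σ' x = x → x ≠ 0 → ∃ n : ℤ, Valued.v x = exp (2 * n))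
    (hπ' : Valued.v π' = exp (-1 : ℤ)) (hdd' : Valued.v (π' - σ' π') = Valued.v π' ^ d')
    (jK : K' →+* K) (hjle : ∀ x y : K', Valued.v (jK x) ≤ Valued.v (jK y) ↔ Valued.v x ≤ Valued.v y) (hjΘ : ∀ x, Θ (jK x) = jK x)
    (hjfix : ∀ z : K, Θ z = z → ∃ x, jK x = z) (hjσ : ∀ x, jK (σ' x) = ρ (jK x)) (hjπ : Valued.v (jK π') = exp (-2 : ℤ))
    {ϖ : K} {dΘ tΘ : ℕ} (hDΘ : IsRamifiedQuadraticDatum Θ ϖ dΘ tΘ)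
    (hFN : ∀ f : K, ρ f = f → Θ f = f → Valued.v f = 1 → ∃ x : K, x * Θ x = f)
    {n₀ : K} (hΘn₀ : Θ n₀ = n₀) (hn₀1 : Valued.v n₀ = 1) (hn₀N : ¬ ∃ z : K, z * Θ z = n₀) (k : ℕ)
    {κ : K} (hκ1 : Valued.v κ = 1) (hκ : Valued.v (κ - 1) ≤ Valued.v (jK π' ^ (d' + k))) :
    (∃ ω : K, Valued.v ω = 1 ∧ Valued.v (κ * (ρ n₀ / n₀) * (ρ (ω * Θ ω) / (ω * Θ ω)) - 1) ≤ Valued.v (jK π' ^ (d' + k))) ↔ k + 2 ≤ dΘ := by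
  rw [← anchored_twist_near_iff_lt_threshold hvΘ hσ' hvσ' hfix' hπ' hdd' jK hjle hjΘ hjfix hjσ hjπ hDΘ hFN hΘn₀ hn₀1 hn₀N k]
  refine exists_congr fun ω => and_congr_right fun hω => ?_
  rw [mul_assoc, v_mul_sub_one_le_iff_of_near_one hκ hκ1]


end Summit.HodgeConjecture.HodgeConjecture.Cruxes.H413.F0P3cDyRamToricLevelCensusRamM

end
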